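import Literature.MathematicalPhysics.QuantumFieldTheory.ContinuumLimits
import HarnessLib

/-!
# Chatterjee's scaling limit of `U(1)` lattice Yang–Mills–Higgs theory (Theorem 3.1)

S. Chatterjee, *A scaling limit of `SU(2)` lattice Yang–Mills–Higgs theory*, Probab. Math. Phys.
**7** (2026) 339–381, arXiv:2401.10507 [Chatterjee2026YMHiggs]: the `U(1)` half of the paper —
§1.3 (the `U(1)` theory with a fixed-length Higgs field and its unitary gauge), §3.1
(**Theorem 3.1**, the scaling limit: "Analogous results are proved for `U(1)` theory as well",
Abstract), §5.2 (**Lemma 5.3**, the law of the gauge-fixed field), §5.6 (**Lemma 5.10**, the key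
estimate). Numbering of arXiv:2401.10507v4 (= the held corpus text), as in the tree's rendering
of the `SU(2)` half: Thm 3.2 = `ContinuumLimits.chatterjee_su2_higgs` (constructive-qft.S19, named
fact), Lemma 5.5 = `SU2HiggsKeyEstimate.integral_su2Deficit_le_keyEstimate` (proved), the Proca
component field = `GaussianFieldOfCovariance.procaComponentCovariance` /
`exists_procaComponentField` (proved). This file follows that rendering decision for decision
(same smearing `finLatticeField`, same infinite-volume Gibbs states as weak limits of odd tori,
same component-wise Proca limit), so that the two theorems read in parallel; statements only
(cross-ladder literature-typing layer, D-0088): every result is a named fact `def … : Prop`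
(D-0014), each PROVED in the source.

## Contents

* `u1HiggsWeight L g α`, `u1HiggsMeasure L g α`: the unitary-gauge `U(1)` Yang–Mills–Higgs law on
  the torus `(ℤ/Lℤ)ᵈ`, density `exp (g⁻² ∑ₚ Re U_p + α² ∑ₑ Re U_e)` against product Haar on
  `U(1)^E` — the printed constants of (1.1)/Lemma 5.3 verbatim (`β = 1/g²` in Wave 0's
  `wilsonWeight u1Rep β`, whose density is `exp (−β ∑ₚ (1 − Re U_p))`), so that no rescaling of
  `g`, `α` intervenes (contrast the `SU(2)` dictionary `g_C = √2 g` of `su2HiggsWeight`).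
* `u1FullHiggsWeight`, `u1FullHiggsMeasure`, `u1UnitaryGauge`, `u1UnitaryGauge_law`
  (**Lemma 5.3**, named fact): the full measure `Z⁻¹ e^{S(U,φ)} ∏ dU_e ∏ dφ_x` on
  `U(1)^E × (S¹)^Λ` with the degenerate (fixed-length) Higgs potential, and the statement that
  the unitary-gauge field `V_e = φ_x^* U_e φ_y` has law `u1HiggsMeasure`.
* `u1HiggsGibbsStates g α` (§1.1/§3.1: infinite-volume Gibbs states as weak limits of the periodic
  measures), `u1GibbsFieldLaw ν L ε c i` (the smeared, renormalised gauge-fixed field component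
  `Im V_{(x, x+eᵢ)}` under `ν`).
* `chatterjee_u1_higgs` (**Theorem 3.1**, named fact): in the regime `α g = c ε`,
  `g = O(ε^{50d})`, the rescaled field converges in law to the Euclidean Proca field of mass `c`
  — component-wise: pairing with `φ dxᵢ` converges to the centred Gaussian of variance
  `procaComponentCovariance c eᵢ φ φ = C_c(φ, φ) + c⁻² C_c(∂ᵢφ, ∂ᵢφ)`.
* `u1Higgs_keyEstimate` (**Lemma 5.10**, named fact): `E|1 − V_e|² ≤ C/(α⁴g²) + C log α/α²` for
  `α ≥ 2`, `α g ≤ 1`, `C = C(d)`, uniformly in the volume.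

## Dictionary and deviations from print (bookkeeping inside the printed proof; repeated at the facts)

* Observable: the tree-style coordinate `Im V_e = sin θ_e` of the gauge-fixed edge variable
  instead of Chatterjee's stereographic `A_e = σ₁(V_e)/g = 2 sin θ_e / (g (1 + cos θ_e))` (§3.1;
  `σ₁` projects `S¹ ∖ {−e₁}` from `−e₁` onto the line `x₁ = 1`): `sin θ = g A (1 + cos θ)/2` with
  `(1 + cos θ)/2 = (1 + Re V)/2 ∈ [1 − δ²/4, 1]` on the event `|1 − V_e| ≤ δ`, `δ = g^{1−aκ} → 0`,
  of Lemmas 5.12–5.13 (as deviation (ii) of `chatterjee_su2_higgs` for `su2Coord`).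
* Smearing: point sampling `φ(εx)` (`finLatticeField`) for the Voronoi-cell averages, and the
  lattice sum truncated to boxes `{−L(ε), …, L(ε)}ᵈ` with `ε L(ε) → ∞` (deviations (iii), (iv)
  there); field factor `cf(ε) = ε^{1−d/2}/g(ε)` from `Z(φ dxᵢ) ≈ ε^{(d+2)/2} ∑ₓ A_{(x,x+eᵢ)} φ(εx)`.
* Volume: Thm 3.1 is about infinite-volume Gibbs states (weak limits `L → ∞` of the periodic
  measures, §1.1, §3.1); the periodic approximants here live on tori of odd side `2Lₙ + 1` (the
  tree's `torusLift`/`box` vocabulary), print identifies opposite faces of `{−L, …, L}ᵈ` (even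
  side `2L`); the printed proof (§5.8 = §5.5 verbatim) is blind to the side (deviation (vi) there).
* `g = O(ε^{50d})` is an eventual bound along `𝓝[>] 0`; `g > 0`, `α g = c ε` for every `ε > 0`
  (deviation (v) there).

Not transcribed: Lemmas 5.11–5.14 (local free-field approximation and the two total-variation
couplings for `U(1)`, "exactly like" Lemmas 5.6–5.9); the open questions of §3.5 (whether
`g = O(ε^{50d})` is necessary — "For `U(1)` theory, it is possible that simply under the conditions
that `αg = cε` and `g → 0` … we obtain the scaling limit given by Theorem 3.1" — are author-posed
QUESTIONS, not theorems, hence not Literature facts; CONVENTIONS §4).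
-/

noncomputable section

open scoped SchwartzMap ENNReal
open MeasureTheory Filter Topology Finset
open Literature.MathematicalPhysics.QuantumLattice
open Literature.Probability.LatticeModels (box)

namespace Literature.MathematicalPhysics.QuantumFieldTheory.Chatterjee2026YMHiggs

variable {d : ℕ}

/-! ### §1.3: the `U(1)` theory with a fixed-length Higgs field, before and after unitary gauge fixing -/

/-- The unitary-gauge `U(1)` lattice Yang–Mills–Higgs weight on the torus `(ℤ/Lℤ)ᵈ` with gauge
coupling `g` and Higgs length `α` (Higgs field of fixed length, gauged to `1`):
`exp (g⁻² ∑ₚ Re U_p + α² ∑ₑ Re U_e) ∏ₑ dU_e` up to the constant `e^{−g⁻²|P|}`, realised as Wave 0's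
`wilsonWeight u1Rep g⁻²` (density `exp (−β ∑ₚ (1 − Re U_p))`, `β = 1/g²`) with the extra edge
density `exp (α² ∑ₑ Re U_e)`. These are the printed constants of the `U(1)` action (1.1),
`S(U, φ) = g⁻² ∑ₚ Re(U_p) + α² ∑_{e=(x,y)} Re(φ_x^* U_e φ_y)`, in the unitary gauge `φ ≡ 1`
(Lemma 5.3). Junk value: for `g = 0` Lean's `(0²)⁻¹ = 0` gives `β = 0`; consumers take `g > 0`.
[cite: Chatterjee2026YMHiggs, §1.3 (1.1) and Lemma 5.3 (§5.2)] -/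
def u1HiggsWeight (L : ℕ) [NeZero L] (g α : ℝ) : Measure (GaugeConfig d L Circle) :=
  (wilsonWeight (d := d) (L := L) u1Rep (g ^ 2)⁻¹).withDensity fun U =>
    ENNReal.ofReal (Real.exp (α ^ 2 * ∑ e : Edge d L, ((U e : Circle) : ℂ).re))

/-- The unitary-gauge `U(1)` lattice Yang–Mills–Higgs probability measure on the torus `(ℤ/Lℤ)ᵈ`:
`u1HiggsWeight` normalised by its total mass — by Lemma 5.3 (`u1UnitaryGauge_law`) the law of the
gauge-fixed field `V`. Junk (the zero measure) if the mass is `0` or `∞`, which does not happen for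
`L ≥ 1` (continuous positive bounded density on a compact space; not proved here).
[cite: Chatterjee2026YMHiggs, §1.3 (the measure μ and the field V) and Lemma 5.3] -/
def u1HiggsMeasure (L : ℕ) [NeZero L] (g α : ℝ) : Measure (GaugeConfig d L Circle) :=
  (u1HiggsWeight (d := d) L g α Set.univ)⁻¹ • u1HiggsWeight L g α

/-- The full (not gauge-fixed) `U(1)` Yang–Mills–Higgs weight on `Σ × Γ = U(1)^E × (S¹)^Λ` with
the degenerate Higgs potential (`W = 0` on `S¹`, `∞` outside, §1.3):
`exp (g⁻² ∑ₚ Re U_p + α² ∑_{e=(x,y)} Re(φ_x^* U_e φ_y)) ∏ₑ dU_e ∏ₓ dφ_x`, `dφ_x` the uniform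
probability measure on `S¹` (= normalised Haar of `U(1)`), up to the constant `e^{−g⁻²|P|}`; the
edge `e = (x, i)` runs from `x` to `y = x + eᵢ` (`Site.shift`). [cite: Chatterjee2026YMHiggs, §1.3 (1.1) and the display defining μ] -/
def u1FullHiggsWeight (L : ℕ) [NeZero L] (g α : ℝ) :
    Measure (GaugeConfig d L Circle × (Site d L → Circle)) :=
  ((wilsonWeight (d := d) (L := L) u1Rep (g ^ 2)⁻¹).prod
      (Measure.pi fun _ : Site d L => haarProbability Circle)).withDensity fun Uφ =>
    ENNReal.ofReal (Real.exp (α ^ 2 * ∑ e : Edge d L,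
      (starRingEnd ℂ ((Uφ.2 e.1 : Circle) : ℂ) * ((Uφ.1 e : Circle) : ℂ) *
        ((Uφ.2 (e.1.shift e.2) : Circle) : ℂ)).re))

/-- The full `U(1)` Yang–Mills–Higgs probability measure `μ` of §1.3 (`u1FullHiggsWeight`
normalised). [cite: Chatterjee2026YMHiggs, §1.3 (the measure μ)] -/
def u1FullHiggsMeasure (L : ℕ) [NeZero L] (g α : ℝ) :
    Measure (GaugeConfig d L Circle × (Site d L → Circle)) :=
  (u1FullHiggsWeight (d := d) L g α Set.univ)⁻¹ • u1FullHiggsWeight L g α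

/-- **Unitary gauge fixing** for the `U(1)` theory (§1.3): `(U, φ) ↦ V` with
`V_e = φ_x^* U_e φ_y = θ(U, φ)_e` for the gauge transform `θ_x = φ_x^*` (so that the transformed
Higgs field is `ψ ≡ 1`); on `U(1)`, `φ_x^* = φ_x⁻¹`. [cite: Chatterjee2026YMHiggs, §1.3 (unitary gauge fixing)] -/
def u1UnitaryGauge {L : ℕ} (Uφ : GaugeConfig d L Circle × (Site d L → Circle)) :
    GaugeConfig d L Circle :=
  fun e => (Uφ.2 e.1)⁻¹ * Uφ.1 e * Uφ.2 (e.1.shift e.2)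

/-- **Lemma 5.3** (the law of the gauge-fixed field; named fact, D-0014 — proved in the source by
the change of variables `U ↦ g(U, φ)`, which preserves product Haar, and `S(U, φ) = S(g(U,φ), 1)`).
*Printed:* "The probability density of `V` with respect to the product of Haar probability
measures on `U(1)^E` is proportional to `exp (g⁻² ∑ₚ Re(U_p) + α² ∑ₑ Re(U_e))` at `U ∈ U(1)^E`",
`V` being the unitary-gauge field of the `U(1)` theory on the finite torus `Λ` under `μ`.
*Rendered:* for `g > 0`, `α > 0` (the standing hypotheses of §1.1) and every torus side `L ≥ 1`,
the push-forward of `u1FullHiggsMeasure L g α` under `u1UnitaryGauge` is `u1HiggsMeasure L g α`.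
[cite: Chatterjee2026YMHiggs, Lemma 5.3 (§5.2); proof ibid.] -/
def u1UnitaryGauge_law : Prop :=
  ∀ (d L : ℕ) [NeZero L] (g α : ℝ), 0 < g → 0 < α →
    (u1FullHiggsMeasure (d := d) L g α).map u1UnitaryGauge = u1HiggsMeasure (d := d) L g α

/-! ### §5.6: the key estimate for `U(1)` theory -/

/-- **Lemma 5.10** (the key estimate for `U(1)` theory; named fact, D-0014 — proved in the source
"exactly like" Lemma 5.5, whose `SU(2)` version the tree proves with explicit constants in
`SU2HiggsKeyEstimate`). *Printed:* "Suppose that `α ≥ 2` and `αg ≤ 1`. Then for any `e ∈ E`,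
`E|1 − V_e|² ≤ C/(α⁴g²) + C log α/α²`, where `C` depends only on the dimension `d`"; here `V` is
the unitary-gauge field on the finite torus `Λ` (§5.6, with `|1 − U|² = 2 − 2 Re(U)`, (5.?)), and
the point of the estimate is its independence of the volume. *Rendered:* for `2 ≤ d` there is
`C` such that for every torus side `L ≥ 1` (print: tori of even side `2L`; the printed proof —
translation invariance, the Haar measure of `Σ' = {|1 − U_e| ≤ α⁻¹ ∀e}`, `E(H) ≤ C L^d/(α²g²)
+ C Lᵈ log α` — is blind to the side), every `g > 0` and `α` with `2 ≤ α`, `α g ≤ 1`, and every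
edge `e`, `∫ |1 − U_e|² d(u1HiggsMeasure L g α) ≤ C/(α⁴ g²) + C log α / α²`.
[cite: Chatterjee2026YMHiggs, Lemma 5.10 (§5.6); proof via Lemma 5.5 (§5.3)] -/
def u1Higgs_keyEstimate : Prop :=
  ∀ d : ℕ, 2 ≤ d → ∃ C : ℝ, ∀ (L : ℕ) [NeZero L] (g α : ℝ), 0 < g → 2 ≤ α → α * g ≤ 1 →
    ∀ e : Edge d L,
      ∫ U, ‖(1 : ℂ) - ((U e : Circle) : ℂ)‖ ^ 2 ∂(u1HiggsMeasure (d := d) L g α) ≤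
        C / (α ^ 4 * g ^ 2) + C * Real.log α / α ^ 2

/-! ### §3.1: infinite-volume Gibbs states and the rescaled field -/

/-- The **infinite-volume Gibbs states** of the unitary-gauge `U(1)` lattice Yang–Mills–Higgs
theory on `ℤᵈ` at gauge coupling `g` and Higgs length `α`, in Chatterjee's sense (§1.1: "Such
Gibbs measures are obtained by taking weak limits of the probability measure `μ` defined above as
`L → ∞`"; §3.1: "consider any infinite volume Gibbs measure obtained by taking a weak limit of the
models on `Λ` under periodic boundary condition, as `L → ∞`. The result stated below does not
depend on the choice of the infinite volume measure"): probability measures `ν` on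
`LGConfig d Circle` that are limits, on continuous cylinder observables, of the periodic lifts
(`torusLift`) of `u1HiggsMeasure (2Lₙ+1) g α` along some `Lₙ → ∞` — verbatim the pattern of
`su2HiggsGibbsStates` (odd torus sides `2Lₙ + 1`, the tree's `Torus.proj`/`box` vocabulary;
print: even sides `2L`). [cite: Chatterjee2026YMHiggs, §1.1 (infinite volume Gibbs measures) and §3.1] -/
def u1HiggsGibbsStates (g α : ℝ) : Set (Measure (LGConfig d Circle)) :=
  {ν | IsProbabilityMeasure ν ∧ ∃ Ls : ℕ → ℕ, Tendsto Ls atTop atTop ∧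
      ∀ (F : LGConfig d Circle → ℝ) (S : Finset (ZdEdge d)), IsCylinder F S → Continuous F →
        Tendsto (fun n : ℕ => ∫ U, F (torusLift (2 * Ls n + 1) U)
            ∂(u1HiggsMeasure (d := d) (2 * Ls n + 1) g α))
          atTop (𝓝 (∫ U, F U ∂ν))}

/-- The law of the smeared, renormalised gauge-fixed field component `i` under a measure `ν` on
`LGConfig d Circle` (an infinite-volume Gibbs state): the real lattice field
`x ↦ Im V_{(x, x+eᵢ)} = sin θ_{(x,i)}` on `ℤᵈ` is smeared at spacing `ε` with field factor `c` over
the box `{−L, …, L}ᵈ` exactly as `finLatticeField`, `Φ_ε(φ) = c εᵈ ∑_{x ∈ box d L} φ(εx) Im V(x, i)`,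
and the law is the push-forward of `ν`. With `c = ε^{1−d/2}/g` this is Chatterjee's `Z_i` paired
with `φ dxᵢ` (§3.1: `A_e = σ₁(V_e)/g`, `Y_i`, `Z(x) = ε^{−(d−2)/2} Y(ε⁻¹x)`), up to the bookkeeping
recorded at `chatterjee_u1_higgs` (`Im V` versus the stereographic `A`, point sampling versus
Voronoi averages, truncation to the box). [cite: Chatterjee2026YMHiggs, §3.1 (the fields A, Y and Z of Thm 3.1)] -/
def u1GibbsFieldLaw (ν : Measure (LGConfig d Circle)) (L : ℕ) (ε c : ℝ) (i : Fin d) :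
    Measure (FieldConfig (EuclideanSpace ℝ (Fin d))) :=
  ν.map fun U => finLatticeField (box d L) ε c fun x => ((U (x, i) : Circle) : ℂ).im

/-- **Theorem 3.1** (Chatterjee's scaling limit of `U(1)` lattice Yang–Mills–Higgs theory; named
fact, D-0014 — proved in the source, §5.6–5.8). *Printed:* `d ≥ 2`; `V` the unitary-gauge field
of the `U(1)` theory (1.1) under "any infinite volume Gibbs measure obtained by taking a weak limit
of the models on `Λ` under periodic boundary condition, as `L → ∞`"; `A_e := σ₁(V_e)/g`
(stereographic projection of `S¹ ∖ {−e₁}` on the line `x₁ = 1`); `Y_i(y) := A_{(x, x+eᵢ)}` for `y`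
in the Voronoi cell of `x ∈ ℤᵈ`; `Z(x) := ε^{−(d−2)/2} Y(ε⁻¹x)`. "Suppose that as `ε → 0`, we
simultaneously send `α → ∞` and `g → 0` such that `αg` remains equal to `cε` for some fixed constant
`c`. Further, suppose that `g = O(ε^{50d})` as `ε → 0`. Then `Z` converges in law to the Euclidean
Proca field with mass `c`" — i.e. (§2.4: the Proca field with parameter `λ` has mass `√λ`) with
parameter `λ = c²`, convergence in law meaning `Z(f) → X(f)` in law for every Schwartzian 1-form
`f` (§2.1), `Var X(f) = (f, R_λ f)` (Def. 2.3). *Rendered* (parallel to `chatterjee_su2_higgs`):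
for `2 ≤ d` and `0 < c`; schemes `g, α : ℝ → ℝ` with `g(ε) > 0` and `α(ε) g(ε) = c ε` for `ε > 0`,
and `g(ε) ≤ C ε^{50d}` eventually as `ε → 0⁺`; every family `ν(ε) ∈ u1HiggsGibbsStates (g ε) (α ε)`;
all truncation half-sides `L(ε)` with `ε L(ε) → ∞`; every direction `i`: the laws
`u1GibbsFieldLaw (ν ε) (L ε) ε (ε^{1−d/2}/g ε) i` converge (`TendstoInLaw` along `𝓝[>] 0`) to the
`eᵢ`-component of the Euclidean Proca field of mass `c`: the centred Gaussian field `μ` on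
`𝒮'(ℝᵈ)` with `∫ e^{iω(φ)} dμ = exp (−½ P_{c,eᵢ}(φ, φ))`,
`P_{c,eᵢ}(φ, ψ) = C_c(φ, ψ) + c⁻² C_c(∂ᵢφ, ∂ᵢψ) = (φ dxᵢ, R_{c²} ψ dxᵢ)`
(`procaComponentCovariance c (EuclideanSpace.single i 1)`; exists and is unique,
`exists_procaComponentField`, `procaComponentField_unique`). *Dictionary:* `u1HiggsMeasure` has
the printed constants (`β = g⁻²`, edge coefficient `α²`), so `α g = c ε` is the printed constraint
and the mass is the printed `c`. *Deviations* (bookkeeping inside the printed proof, as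
(i)–(vi) at `chatterjee_su2_higgs`): one direction component at a time (joint Gaussianity across
directions printed, not transcribed); the observable `Im V_e = sin θ_e = g A_e (1 + cos θ_e)/2`
for the stereographic `A_e`, with `(1 + cos θ_e)/2 ∈ [1 − δ²/4, 1]` on the event `|1 − V_e| ≤ δ`,
`δ → 0`, of Lemmas 5.12–5.13; point sampling for Voronoi averages; truncation of the lattice sum
to `{−L(ε), …, L(ε)}ᵈ`, `ε L(ε) → ∞`; eventual `O(ε^{50d})`; odd torus sides in
`u1HiggsGibbsStates`. [cite: Chatterjee2026YMHiggs, Thm 3.1 (§3.1, with §1.1: infinite-volume Gibbs measures; §2.1: convergence in law; Def. 2.3 (2.4) and §2.4: the Proca field of mass c); proof §5.6–5.8] -/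
def chatterjee_u1_higgs : Prop :=
  ∀ (d : ℕ), 2 ≤ d → ∀ (c : ℝ), 0 < c →
    ∀ (g α : ℝ → ℝ), (∀ ε, 0 < ε → 0 < g ε) → (∀ ε, 0 < ε → α ε * g ε = c * ε) →
      (∃ C : ℝ, ∀ᶠ ε in 𝓝[>] (0 : ℝ), g ε ≤ C * ε ^ (50 * d)) →
      ∀ ν : ℝ → Measure (LGConfig d Circle),
        (∀ ε, 0 < ε → ν ε ∈ u1HiggsGibbsStates (d := d) (g ε) (α ε)) →
      ∀ L : ℝ → ℕ, Tendsto (fun ε : ℝ => ε * L ε) (𝓝[>] 0) atTop →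
      ∀ i : Fin d,
        ∃ μ : Measure (FieldConfig (EuclideanSpace ℝ (Fin d))),
          IsGaussianField μ ∧
          (∀ φ : 𝓢(EuclideanSpace ℝ (Fin d), ℝ), genFunctional μ φ =
            Complex.exp (-(1 / 2 : ℂ) *
              (procaComponentCovariance c (EuclideanSpace.single i (1 : ℝ)) φ φ : ℂ))) ∧
          TendstoInLaw
            (fun ε : ℝ => u1GibbsFieldLaw (ν ε) (L ε) ε (ε ^ (1 - (d : ℝ) / 2) / g ε) i)
            (𝓝[>] 0) μ

end Literature.MathematicalPhysics.QuantumFieldTheory.Chatterjee2026YMHiggs
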